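/-
Copyright (c) 2026 the pub-hodgecm-mathlib formalisation cell (harness21).  Prover seat hodgecm-mathlib-K2E3-p14 (g10) (E3 hand on strike line L1; LEAD F0P6-plan (g15)
BATCH #226 «(F-tail-arch) road END TO END»), Track B «K2-LIT» ∕ hLiu418 = `stmt-HodgeConjecture-24832`: U1-glob LEVEL 2-fin, the ARCH-KERNEL branch — (F-tail-arch) FILE 4,
THE PACKAGE: the arch twin of ★ p863777 `K2LiuLocalKernelPlaceLettersAtKernelPlace.exists_kernelPlace_tailPackage`.  THEOREMS ONLY (no `def` ∕ `instance` ∕ notation ∕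
named-fact hypothesis ∕ `sorry`).
-/
import Summits.HodgeConjecture.HodgeConjecture.Theorems.K2LiuLocalKernelArchTailOfRecord          -- ★ (F-tail-arch) FILE 2 (this seat): `smul_whittakerDelta_eq_arch_mul_rest_of_letters` (+ ★ FILE 1, ★ G1)
import Summits.HodgeConjecture.HodgeConjecture.Theorems.K2LiuStdSectionPlaceLettersOfRecord      -- ★ (o1) p863289 (K2E3-p28): `exists_placeLetters_of_isStandard` (+ ★ Φ3b via ★ (E3))
import Summits.HodgeConjecture.HodgeConjecture.Theorems.K2LiuStdExtensionPureArch                -- ★ (F-tail-arch) FILE 3 p864088 (this seat): `stdExtension_placesEmbed_eq_mul_of_pureArch`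
import Summits.HodgeConjecture.HodgeConjecture.Theorems.K2LiuStdExtensionDatumMonotone             -- ★ (K2Liu-p13): `stdExtension_eq_of_le'`
import Summits.HodgeConjecture.HodgeConjecture.Theorems.K2LiuLocalKernelPlaceLettersAtKernelPlace  -- ★ p863777 (K2E3-p28): brings ★ Φ3b `exists_isHaarMeasure_map_unipDeltaSplit_eq_prod_pi_rpMeasure`, ★ `modDelta_eq_one_of_mem`
import HarnessLib

/-!
# Crux `HLiu418`, U1-glob LEVEL 2-fin, arch-kernel branch — (F-tail-arch) FILE 4 `K2LiuLocalKernelArchTailPackage`: THE GLOBAL-TAIL PACKAGE AT AN ARCHIMEDEAN KERNEL PLACE,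
# `obtain`-READY: `∃ T, bA, rT, ν_∞, HT_f` with `bA` = the arch flat family through `b` AT THE ADAPTED DATUM `𝒦' ⊇ 𝒦`, `HT_f` = ★ FILE 1's FINITE head, and for ALL `(c, D, P, Fn)`:
# `c • W_S(f_s)(h) = Fn(s) · ((c:ℂ) · HT_f(s,h) · [ζ^{T}(2s)∕(ζ^{T}(2s+1)·L^{T}(2s+2,ε))] · ∏_{v∈D} P_v(s))` on `{n∕2 < re s}`   [KudlaRallis1994 §2; Tan1999 §3–§4]

Cell `hodgecm-mathlib`, crux item hLiu418 = `stmt-HodgeConjecture-24832`; squad K2, strike line L1, LEAD F0P6-plan (g15); U1 desk K2E3-p28 (g3); END pen K2E3-p32 (g3);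
prover K2E3-p14 (g10).  Lane `--supports stmt-HodgeConjecture-24832 --as helper` (count-neutral).  THEOREMS ONLY.  General frame `e : Fin N × Fin M ≃ Fin n` (`1 ≤ n`), general
index `S`, general base parameter `s₀` (LEVEL 2: `s₀ = ½`, `S = S♭`, `n = 2`).

THE POINT ((F-arch) ★ p863937 `archCornerPackage_cm`'s by-value letter `htail∞`, assembled).  At the U1-glob(σ) data — `𝒦 ≤ 𝒦'` STANDARD, `χ` unitary, `f := stdExtension 𝒦 s₀ φ` a
`𝒦`-standard family with continuous members, `φ` PURE AT `∞` (`φ h = a (h_f) · b (h_∞)`, `b` the `K_∞`-finite archimedean section carrying the kernel vector at the real place `σ`,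
with the archimedean Siegel law `hb` at `s₀`), an index `S`, a point `h`, a Haar `νN` on `N_Δ(𝔸)`, the desk's FIXED local carriers `νv` pinned off `TK` and the level guard
`(𝒦'.K)_v ⊆ K_{H,v}` off `TK𝒦'` — this file RUNS the three `obtain`s once at `T := (T₀ ∪ TK) ∪ TK𝒦'`: ★ (o1) `exists_placeLetters_of_isStandard` at `𝒦` (`hχ hfac hh hw hS` off `T₀`),
★ Φ3b `exists_isHaarMeasure_map_unipDeltaSplit_eq_prod_pi_rpMeasure` (`ν_∞`, `hmap`), ★ (F-tail-arch) FILE 3 `stdExtension_placesEmbed_eq_mul_of_pureArch` at the LARGER standard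
datum `𝒦'` (bridged to `𝒦` by ★ `stdExtension_eq_of_le'`) — and EXPORTS what FILE B's arch branch must name: `T ⊇ TK ∪ TK𝒦'`, `bA` (with its letters: archimedean Siegel law at
every `s` ★ `heightTwistArch_siegel`, flat on `(·,1)⁻¹(𝒦'.K)`, `bA s₀ = b`, the height-twist formula with `𝒦'.pPart`), `rT` (with its EXPLICIT formula), `ν_∞` (Haar, σ-finite), the
purity `hpure` and the FINITE head `HT_f` (an `rfl`-clause `hHT`: ★ FILE 1's bracket head over `⨂_{v∈T} ν_v`, so ★ (F-rest) `exists_clearedRest_kernelPlace`'s `hsplit` is read off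
it at `Tw := T`) — followed by the identity for ALL later letters `(c, D, hDT, P, hP1, hI, Fn, hloc)` (universally quantified AFTER the `∃`, since they mention `T`):
* §1 **`exists_archKernel_tailPackage`** (★ FILE 2 `smul_whittakerDelta_eq_arch_mul_rest_of_letters` inside).
BY VALUE after this file: the arch reading `hloc : ∫ conj ψ_S(a_∞) · bA_s(w_{Δ,∞} a h_∞) dν_∞ = Fn s` with `Fn`'s continuation ∕ deadness ((K1a-3-arch) lineage; U1-glob(σ) via ★
p863937 §2), and the faces split of `rT` for ★ (F-rest) (the arch twin of K2E3-p28's (F-split)).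
References: [KudlaRallis1994] §2 (2.10)–(2.12); [Tan1999] §1 p. 166, §3, §4 Prop. 4.8; [BorelJacquet1979] §4.1; [CasselsFrohlichANT1967] Ch. XV (Tate) Thm. 3.3.1.
HONEST LABEL.  Count-neutral helper (pure `obtain` plumbing, zero new mathematics): `HC_CM` is proved only modulo the 7 printed citations (2 remaining named inputs: hLiu418 =
`stmt-HodgeConjecture-24832`, h413 = `stmt-HodgeConjecture-24833`) until rung 0 closes; U1-glob LEVEL 2 stays OPEN (FILE B; `hdead∞`; (F-split-arch)).
-/

set_option autoImplicit false
set_option linter.dupNamespace false -- the mandated namespace repeats `HodgeConjecture.HodgeConjecture`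

noncomputable section

open scoped Matrix RestrictedProduct ENNReal NNReal Topology ComplexConjugate
open NumberField IsDedekindDomain MeasureTheory Measure Filter Set

namespace Summit.HodgeConjecture.HodgeConjecture.Cruxes.HLiu418.K2LiuLocalKernelArchTailPackage

open Literature.NumberTheory.Automorphic Literature.NumberTheory.LFunctions Literature.NumberTheory.GaloisRepresentations
open Literature.NumberTheory.GelbartRogawski1991 Literature.NumberTheory.GelbartRogawski1991.GRConstruction
open Literature.NumberTheory.GelbartRogawski1991.UnitaryDualPair
open Literature.NumberTheory.K2Lit.SiegelDoubled Literature.NumberTheory.K2Lit.LocalSiegelDoubled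
open Literature.NumberTheory.K2Lit.PlaceSplitting
open Literature.MeasureTheory.RestrictedProduct
open Literature.Topology.Algebra.RestrictedProduct (inH)
open Summit.HodgeConjecture.HodgeConjecture.Cruxes.HLiu418.K2LiuSiegelUnipotentLocalDefs
open Summit.HodgeConjecture.HodgeConjecture.Cruxes.HLiu418.K2LiuSiegelUnipotentSplitDefs
open Summit.HodgeConjecture.HodgeConjecture.Cruxes.HLiu418.K2LiuSiegelUnipotentSplitAtDefs
open Summit.HodgeConjecture.HodgeConjecture.Cruxes.HLiu418.K2LiuSiegelUnipotentFourierDefs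
open Summit.HodgeConjecture.HodgeConjecture.Cruxes.HLiu418.K2LiuSiegelUnipotentHaarPinned (exists_isHaarMeasure_map_unipDeltaSplit_eq_prod_pi_rpMeasure)
open Summit.HodgeConjecture.HodgeConjecture.Cruxes.HLiu418.K2LiuLocalKernelArchTailOfRecord (smul_whittakerDelta_eq_arch_mul_rest_of_letters)
open Summit.HodgeConjecture.HodgeConjecture.Cruxes.HLiu418.K2LiuStdSectionPlaceLettersOfRecord (exists_placeLetters_of_isStandard)
open Summit.HodgeConjecture.HodgeConjecture.Cruxes.HLiu418.K2LiuStdExtensionPureArch (stdExtension_placesEmbed_eq_mul_of_pureArch)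
open Summit.HodgeConjecture.HodgeConjecture.Cruxes.HLiu418.K2LiuStdFamilyAwayPurityFlat (heightTwistArch_siegel heightTwistArch_kfinite continuous_heightTwistArch)
open Summit.HodgeConjecture.HodgeConjecture.Cruxes.HLiu418.K2LiuIwasawaDeltaUnimodular (IwasawaDatum.modDelta_eq_one_of_mem)
open Summit.HodgeConjecture.HodgeConjecture.Cruxes.HLiu418.K2LiuStdExtensionDatumMonotone (stdExtension_eq_of_le')

variable (L : Type) [Field L] [NumberField L] [IsCMField L]
variable {N M n : ℕ} (e : Fin N × Fin M ≃ Fin n)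
  (dV : Fin N → L) (hdV : ∀ i, IsCMField.complexConj L (dV i) = dV i)
  (dW : Fin M → L) (hdW : ∀ i, IsCMField.complexConj L (dW i) = dW i)
  [DecidableEq (HeightOneSpectrum (𝓞 (Fp L)))]
  [MeasurableSpace ↥(unipDelta L e dV hdV dW hdW)] [BorelSpace ↥(unipDelta L e dV hdV dW hdW)]
  [MeasurableSpace ↥(unipDeltaArch L e dV hdV dW hdW)] [BorelSpace ↥(unipDeltaArch L e dV hdV dW hdW)]
  [∀ v : HeightOneSpectrum (𝓞 (Fp L)), MeasurableSpace ↥(unipDeltaLoc L e dV hdV dW hdW v)] [∀ v : HeightOneSpectrum (𝓞 (Fp L)), BorelSpace ↥(unipDeltaLoc L e dV hdV dW hdW v)]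

/-! ## §1 The package -/

set_option maxHeartbeats 2400000 in -- MEASURED class of ★ p863777's statement (`whnf`: 1 600 000 ✗, 2 400 000 ✓ there): ★ FILE 2's 1 200 000 telescope under the 5-fold `∃` + the exported letters; proof is `obtain`∕`rw`∕`exact` only
/-- **THE GLOBAL-TAIL PACKAGE AT AN ARCHIMEDEAN KERNEL PLACE (FILE B's arch-branch `obtain`).**  `𝒦 ≤ 𝒦'` standard Iwasawa data (`𝒦.K ≤ 𝒦'.K`) with `(𝒦'.K)_v ⊆ K_{H,v}` off `TK𝒦'`;
`χ` unitary; `f := stdExtension 𝒦 s₀ φ` `𝒦`-standard with continuous members; `φ` pure at `∞` through `(a, b)` with the archimedean Siegel law of `b` at `s₀` (`hb`); `S`, `h`; Haar `νN`;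
local carriers `νv` pinned off `TK`.  THEN `∃ T` (`TK ∪ TK𝒦' ⊆ T`), `bA` = the arch flat family through `b` at `𝒦'` (Siegel law at every `s`, flat on `(·,1)⁻¹(𝒦'.K)`, `bA s₀ = b`, formula;
`K_∞`-finite w.r.t. `𝒦'.K` and continuous at every `s` from `(hbfin, hbc)` — ★ (E6′)'s letters), `rT` (formula), `ν_∞`, `HT_f` = ★ FILE 1's FINITE head (`hHT`), such that for ALL scalars `c`, collapse letters `(D, P, hI)` and arch readings `(Fn, hloc)`:
`c • W_S(f_s)(h) = Fn s · ((c:ℂ) · HT_f s h · [ζ^{↑T}(2s)∕(ζ^{↑T}(2s+1)·L^{↑T}(2s+2,ε))] · ∏_{v∈D} P_v(s))` on `{n∕2 < re s}`. [cite: KudlaRallis1994, §2] [cite: Tan1999, §1 p. 166; §4 Prop. 4.8]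
[cite: BorelJacquet1979, §4.1] [cite: CasselsFrohlichANT1967, Ch. XV (Tate) Thm. 3.3.1] -/
theorem exists_archKernel_tailPackage (hdV0 : ∀ i, dV i ≠ 0) (hdW0 : ∀ i, dW i ≠ 0) (hn : 1 ≤ n)
    {𝒦 𝒦' : IwasawaDatum L e dV hdV dW hdW} (h𝒦 : 𝒦.IsStd) (h𝒦' : 𝒦'.IsStd) (hle : 𝒦.K ≤ 𝒦'.K)
    (TK𝒦' : Finset (HeightOneSpectrum (𝓞 (Fp L))))
    (hKT' : ∀ k ∈ 𝒦'.K, ∀ v, v ∉ TK𝒦' → UnitaryGroup.evalPlace (Fp L) L (IsCMField.complexConj L) (n + n) (hermD L e dV hdV dW hdW) v (UnitaryGroup.finPart (Fp L) L (IsCMField.complexConj L) (n + n) (hermD L e dV hdV dW hdW) k) ∈ UnitaryGroup.localInt L (IsCMField.complexConj L) (n + n) (hermD L e dV hdV dW hdW) v)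
    {χ : HeckeCharacter L} (hχu : χ.IsUnitary) (s₀ : ℂ) {φ : HA L e dV hdV dW hdW → ℂ}
    (hstd : IsStandardSectionFamily 𝒦 χ (stdExtension 𝒦 s₀ φ)) (hcont : ∀ s, Continuous (stdExtension 𝒦 s₀ φ s))
    {a : UnitaryGroup.finAdelic (Fp L) L (IsCMField.complexConj L) (n + n) (hermD L e dV hdV dW hdW) → ℂ} {b : UnitaryGroup.arch (Fp L) L (IsCMField.complexConj L) (n + n) (hermD L e dV hdV dW hdW) → ℂ}
    (hb : ∀ p : HA L e dV hdV dW hdW, IsSiegelDelta L e dV hdV dW hdW p → UnitaryGroup.finPart (Fp L) L (IsCMField.complexConj L) (n + n) (hermD L e dV hdV dW hdW) p = 1 →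
      ∀ x : UnitaryGroup.arch (Fp L) L (IsCMField.complexConj L) (n + n) (hermD L e dV hdV dW hdW), b (UnitaryGroup.archPart (Fp L) L (IsCMField.complexConj L) (n + n) (hermD L e dV hdV dW hdW) p * x) = siegelDeltaCharacter L e dV hdV dW hdW χ s₀ p * b x)
    (hbfin : ∃ V : Submodule ℂ (UnitaryGroup.arch (Fp L) L (IsCMField.complexConj L) (n + n) (hermD L e dV hdV dW hdW) → ℂ), FiniteDimensional ℂ V ∧ b ∈ V ∧
      ∀ a₀ : UnitaryGroup.arch (Fp L) L (IsCMField.complexConj L) (n + n) (hermD L e dV hdV dW hdW), (UnitaryGroup.archToAdelic (Fp L) L (IsCMField.complexConj L) (n + n) (hermD L e dV hdV dW hdW) a₀ : HA L e dV hdV dW hdW) ∈ 𝒦'.K → ∀ G ∈ V, (fun x => G (x * a₀)) ∈ V)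
    (hbc : Continuous b)
    (hφ : ∀ h : HA L e dV hdV dW hdW, φ h = a (UnitaryGroup.finPart (Fp L) L (IsCMField.complexConj L) (n + n) (hermD L e dV hdV dW hdW) h) * b (UnitaryGroup.archPart (Fp L) L (IsCMField.complexConj L) (n + n) (hermD L e dV hdV dW hdW) h))
    (S : Matrix (Fin n) (Fin n) L) (h : HA L e dV hdV dW hdW)
    (νN : Measure ↥(unipDelta L e dV hdV dW hdW)) [νN.IsHaarMeasure]
    (νv : ∀ v : HeightOneSpectrum (𝓞 (Fp L)), Measure ↥(unipDeltaLoc L e dV hdV dW hdW v)) [∀ v, (νv v).IsHaarMeasure] [∀ v, SigmaFinite (νv v)]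
    (TK : Finset (HeightOneSpectrum (𝓞 (Fp L))))
    (hνK : ∀ v, v ∉ TK → νv v (((inH (fun v => UnitaryGroup.localInt L (IsCMField.complexConj L) (n + n) (hermD L e dV hdV dW hdW) v) (fun v => unipDeltaLoc L e dV hdV dW hdW v) v) : Subgroup ↥(unipDeltaLoc L e dV hdV dW hdW v)) : Set ↥(unipDeltaLoc L e dV hdV dW hdW v)) = 1) :
    ∃ (T : Finset (HeightOneSpectrum (𝓞 (Fp L))))
      (bA : ℂ → UnitaryGroup.arch (Fp L) L (IsCMField.complexConj L) (n + n) (hermD L e dV hdV dW hdW) → ℂ)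
      (rT : ℂ → (Π v : T, UnitaryGroup.localPi L (IsCMField.complexConj L) (n + n) (hermD L e dV hdV dW hdW) v.1) → ℂ)
      (νinf : Measure ↥(unipDeltaArch L e dV hdV dW hdW)) (HT : ℂ → HA L e dV hdV dW hdW → ℂ),
      TK ∪ TK𝒦' ⊆ T ∧
      (∀ (s : ℂ) (p : HA L e dV hdV dW hdW), IsSiegelDelta L e dV hdV dW hdW p → UnitaryGroup.finPart (Fp L) L (IsCMField.complexConj L) (n + n) (hermD L e dV hdV dW hdW) p = 1 →
        ∀ x : UnitaryGroup.arch (Fp L) L (IsCMField.complexConj L) (n + n) (hermD L e dV hdV dW hdW), bA s (UnitaryGroup.archPart (Fp L) L (IsCMField.complexConj L) (n + n) (hermD L e dV hdV dW hdW) p * x) = siegelDeltaCharacter L e dV hdV dW hdW χ s p * bA s x) ∧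
      (∀ s : ℂ, ∃ V : Submodule ℂ (UnitaryGroup.arch (Fp L) L (IsCMField.complexConj L) (n + n) (hermD L e dV hdV dW hdW) → ℂ), FiniteDimensional ℂ V ∧ bA s ∈ V ∧
        ∀ a₀ : UnitaryGroup.arch (Fp L) L (IsCMField.complexConj L) (n + n) (hermD L e dV hdV dW hdW), (UnitaryGroup.archToAdelic (Fp L) L (IsCMField.complexConj L) (n + n) (hermD L e dV hdV dW hdW) a₀ : HA L e dV hdV dW hdW) ∈ 𝒦'.K → ∀ G ∈ V, (fun x => G (x * a₀)) ∈ V) ∧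
      (∀ s : ℂ, Continuous (bA s)) ∧
      (∀ (s s' : ℂ) (a₀ : UnitaryGroup.arch (Fp L) L (IsCMField.complexConj L) (n + n) (hermD L e dV hdV dW hdW)), (UnitaryGroup.archToAdelic (Fp L) L (IsCMField.complexConj L) (n + n) (hermD L e dV hdV dW hdW) a₀ : HA L e dV hdV dW hdW) ∈ 𝒦'.K → bA s a₀ = bA s' a₀) ∧
      bA s₀ = b ∧
      (∀ (s : ℂ) (yi : UnitaryGroup.arch (Fp L) L (IsCMField.complexConj L) (n + n) (hermD L e dV hdV dW hdW)), bA s yi = ((modDelta L e dV hdV dW hdW (𝒦'.pPart (UnitaryGroup.archToAdelic (Fp L) L (IsCMField.complexConj L) (n + n) (hermD L e dV hdV dW hdW) yi)) : ℝ) : ℂ) ^ (2 * (s - s₀)) * b yi) ∧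
      νinf.IsHaarMeasure ∧ SigmaFinite νinf ∧
      (∀ (s : ℂ) (yi : UnitaryGroup.arch (Fp L) L (IsCMField.complexConj L) (n + n) (hermD L e dV hdV dW hdW)) (y : Π v : T, UnitaryGroup.localPi L (IsCMField.complexConj L) (n + n) (hermD L e dV hdV dW hdW) v.1),
        stdExtension 𝒦 s₀ φ s (placesEmbed L (hermD L e dV hdV dW hdW) T (yi, y)) = bA s yi * rT s y) ∧
      (∀ (s : ℂ) (y : Π v : T, UnitaryGroup.localPi L (IsCMField.complexConj L) (n + n) (hermD L e dV hdV dW hdW) v.1),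
        rT s y = ((modDelta L e dV hdV dW hdW (𝒦'.pPart (placesEmbed L (hermD L e dV hdV dW hdW) T ((1 : UnitaryGroup.arch (Fp L) L (IsCMField.complexConj L) (n + n) (hermD L e dV hdV dW hdW)), y))) : ℝ) : ℂ) ^ (2 * (s - s₀)) *
          a (placesEmbedFin L (hermD L e dV hdV dW hdW) T y)) ∧
      (∀ (s : ℂ) (h' : HA L e dV hdV dW hdW), HT s h' =
        ∫ q, (∏ v : T, conj (unipDeltaChar L e dV hdV dW hdW S
              (locToAdelic L e dV hdV dW hdW v.1
                ((q v : ↥(unipDeltaLoc L e dV hdV dW hdW v.1)) : UnitaryGroup.localPi L (IsCMField.complexConj L) (n + n) (hermD L e dV hdV dW hdW) v.1)) : ℂ)) *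
          rT s (fun v : T => UnitaryGroup.evalPlace (Fp L) L (IsCMField.complexConj L) (n + n) (hermD L e dV hdV dW hdW) v.1
                  (UnitaryGroup.finPart (Fp L) L (IsCMField.complexConj L) (n + n) (hermD L e dV hdV dW hdW) (weylDelta L e dV hdV dW hdW)) *
                ((q v : ↥(unipDeltaLoc L e dV hdV dW hdW v.1)) : UnitaryGroup.localPi L (IsCMField.complexConj L) (n + n) (hermD L e dV hdV dW hdW) v.1) *
                UnitaryGroup.evalPlace (Fp L) L (IsCMField.complexConj L) (n + n) (hermD L e dV hdV dW hdW) v.1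
                  (UnitaryGroup.finPart (Fp L) L (IsCMField.complexConj L) (n + n) (hermD L e dV hdV dW hdW) h'))
          ∂(Measure.pi fun v : T => νv v.1)) ∧
      ∀ (c : ℝ) (D : Finset (HeightOneSpectrum (𝓞 (Fp L)))) (_hDT : ∀ v ∈ D, v ∉ T) (P : HeightOneSpectrum (𝓞 (Fp L)) → ℂ → ℂ)
        (_hP1 : ∀ v, v ∉ T → v ∉ D → ∀ s : ℂ, P v s = 1)
        (_hI : ∀ s : ℂ, (n : ℝ) / 2 < s.re → ∀ v : {v : HeightOneSpectrum (𝓞 (Fp L)) // v ∉ T},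
          ∫ y, conj (unipDeltaChar L e dV hdV dW hdW S
                (locToAdelic L e dV hdV dW hdW v.1 (y : UnitaryGroup.localPi L (IsCMField.complexConj L) (n + n) (hermD L e dV hdV dW hdW) v.1)) : ℂ) *
              LambdaLoc L e dV hdV dW hdW v.1 χ s
                (UnitaryGroup.evalPlace (Fp L) L (IsCMField.complexConj L) (n + n) (hermD L e dV hdV dW hdW) v.1
                    (UnitaryGroup.finPart (Fp L) L (IsCMField.complexConj L) (n + n) (hermD L e dV hdV dW hdW) (weylDelta L e dV hdV dW hdW)) *
                  (y : UnitaryGroup.localPi L (IsCMField.complexConj L) (n + n) (hermD L e dV hdV dW hdW) v.1)) ∂(νv v.1) =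
            ((1 - (v.1.residueCard : ℂ) ^ (-(2 * s + 1))) *
                (1 - (quadraticHeckeCharCM L).valueAtUniformizer v.1 * (v.1.residueCard : ℂ) ^ (-(2 * s + 2)))) /
              (1 - (v.1.residueCard : ℂ) ^ (-(2 * s))) * P v.1 s)
        (Fn : ℂ → ℂ)
        (_hloc : ∀ s : ℂ, (n : ℝ) / 2 < s.re →
          ∫ a', conj (unipDeltaChar L e dV hdV dW hdW S (UnitaryGroup.archToAdelic (Fp L) L (IsCMField.complexConj L) (n + n) (hermD L e dV hdV dW hdW) (a' : UnitaryGroup.arch (Fp L) L (IsCMField.complexConj L) (n + n) (hermD L e dV hdV dW hdW))) : ℂ) *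
              bA s (UnitaryGroup.archPart (Fp L) L (IsCMField.complexConj L) (n + n) (hermD L e dV hdV dW hdW) (weylDelta L e dV hdV dW hdW) * (a' : UnitaryGroup.arch (Fp L) L (IsCMField.complexConj L) (n + n) (hermD L e dV hdV dW hdW)) * UnitaryGroup.archPart (Fp L) L (IsCMField.complexConj L) (n + n) (hermD L e dV hdV dW hdW) h) ∂νinf = Fn s),
        ∀ s : ℂ, (n : ℝ) / 2 < s.re →
          c • whittakerDelta L e dV hdV dW hdW νN S (stdExtension 𝒦 s₀ φ s) h =
            Fn s *
              ((c : ℂ) * HT s h *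
                (partialStandardL (↑T : Set (HeightOneSpectrum (𝓞 (Fp L)))) (fun _ => {1}) (2 * s) /
                  (partialStandardL (↑T : Set (HeightOneSpectrum (𝓞 (Fp L)))) (fun _ => {1}) (2 * s + 1) *
                    partialStandardL (↑T : Set (HeightOneSpectrum (𝓞 (Fp L)))) (fun v => {(quadraticHeckeCharCM L).valueAtUniformizer v}) (2 * s + 2))) *
                ∏ v ∈ D, P v s) := by
  -- ★ (o1): the five data letters off `T₀`; the place set of record `T := (T₀ ∪ TK) ∪ TK𝒦'`
  obtain ⟨T₀, hT₀⟩ := exists_placeLetters_of_isStandard L e dV hdV dW hdW hdV0 hdW0 h𝒦 hstd hcont h S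
  set T : Finset (HeightOneSpectrum (𝓞 (Fp L))) := (T₀ ∪ TK) ∪ TK𝒦' with hTdef
  have hT₀T : T₀ ⊆ T := fun v hv => Finset.mem_union_left _ (Finset.mem_union_left _ hv)
  have hTKT : TK ⊆ T := fun v hv => Finset.mem_union_left _ (Finset.mem_union_right _ hv)
  have hTK𝒦T : TK𝒦' ⊆ T := fun v hv => Finset.mem_union_right _ hv
  obtain ⟨hχT, hfac, hhT, hwT, hST⟩ := hT₀ T hT₀T
  have hνKT : ∀ v, v ∉ T → νv v (((inH (fun v => UnitaryGroup.localInt L (IsCMField.complexConj L) (n + n) (hermD L e dV hdV dW hdW) v) (fun v => unipDeltaLoc L e dV hdV dW hdW v) v) : Subgroup ↥(unipDeltaLoc L e dV hdV dW hdW v)) : Set ↥(unipDeltaLoc L e dV hdV dW hdW v)) = 1 :=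
    fun v hv => hνK v fun h' => hv (hTKT h')
  have hKT'T : ∀ k ∈ 𝒦'.K, ∀ v, v ∉ T → UnitaryGroup.evalPlace (Fp L) L (IsCMField.complexConj L) (n + n) (hermD L e dV hdV dW hdW) v (UnitaryGroup.finPart (Fp L) L (IsCMField.complexConj L) (n + n) (hermD L e dV hdV dW hdW) k) ∈ UnitaryGroup.localInt L (IsCMField.complexConj L) (n + n) (hermD L e dV hdV dW hdW) v :=
    fun k hk v hv => hKT' k hk v fun h' => hv (hTK𝒦T h')
  -- ★ Φ3b: the archimedean carrier for the desk's `νv`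
  obtain ⟨νinf, hνinf, hσ, hmap⟩ := exists_isHaarMeasure_map_unipDeltaSplit_eq_prod_pi_rpMeasure L e dV hdV dW hdW T νN νv hνKT
  haveI := hνinf
  haveI := hσ
  -- ★ (F-tail-arch) FILE 3 §1 at the LARGER standard datum `𝒦'`, with EXPLICIT `bA`, `rT` (★ (E6′)'s arch height twist), bridged to `𝒦` by ★ `stdExtension_eq_of_le'`
  have hK' : 𝒦'.IsDeltaUnimodular := IwasawaDatum.modDelta_eq_one_of_mem L e dV hdV hdV0 dW hdW hdW0 𝒦'
  obtain ⟨bA, hbA⟩ : ∃ bA : ℂ → UnitaryGroup.arch (Fp L) L (IsCMField.complexConj L) (n + n) (hermD L e dV hdV dW hdW) → ℂ,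
      bA = fun s yi => ((modDelta L e dV hdV dW hdW (𝒦'.pPart (UnitaryGroup.archToAdelic (Fp L) L (IsCMField.complexConj L) (n + n) (hermD L e dV hdV dW hdW) yi)) : ℝ) : ℂ) ^ (2 * (s - s₀)) * b yi := ⟨_, rfl⟩
  obtain ⟨rT, hrT⟩ : ∃ rT : ℂ → (Π v : T, UnitaryGroup.localPi L (IsCMField.complexConj L) (n + n) (hermD L e dV hdV dW hdW) v.1) → ℂ,
      rT = fun s y => ((modDelta L e dV hdV dW hdW (𝒦'.pPart (placesEmbed L (hermD L e dV hdV dW hdW) T ((1 : UnitaryGroup.arch (Fp L) L (IsCMField.complexConj L) (n + n) (hermD L e dV hdV dW hdW)), y))) : ℝ) : ℂ) ^ (2 * (s - s₀)) *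
        a (placesEmbedFin L (hermD L e dV hdV dW hdW) T y) := ⟨_, rfl⟩
  have hpure : ∀ (s : ℂ) (yi : UnitaryGroup.arch (Fp L) L (IsCMField.complexConj L) (n + n) (hermD L e dV hdV dW hdW)) (y : Π v : T, UnitaryGroup.localPi L (IsCMField.complexConj L) (n + n) (hermD L e dV hdV dW hdW) v.1),
      stdExtension 𝒦 s₀ φ s (placesEmbed L (hermD L e dV hdV dW hdW) T (yi, y)) = bA s yi * rT s y := fun s yi y => by
    rw [hbA, hrT, ← stdExtension_eq_of_le' hdV0 hdW0 hle s₀ φ]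
    exact stdExtension_placesEmbed_eq_mul_of_pureArch L e dV hdV hdV0 dW hdW hdW0 T h𝒦' hKT'T s₀ hφ s yi y
  have hSieg : ∀ (s : ℂ) (p : HA L e dV hdV dW hdW), IsSiegelDelta L e dV hdV dW hdW p → UnitaryGroup.finPart (Fp L) L (IsCMField.complexConj L) (n + n) (hermD L e dV hdV dW hdW) p = 1 →
      ∀ x : UnitaryGroup.arch (Fp L) L (IsCMField.complexConj L) (n + n) (hermD L e dV hdV dW hdW), bA s (UnitaryGroup.archPart (Fp L) L (IsCMField.complexConj L) (n + n) (hermD L e dV hdV dW hdW) p * x) = siegelDeltaCharacter L e dV hdV dW hdW χ s p * bA s x := fun s => by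
    rw [hbA]; exact heightTwistArch_siegel L e dV hdV hdV0 dW hdW hdW0 𝒦' hb s
  have hkfin : ∀ s : ℂ, ∃ V : Submodule ℂ (UnitaryGroup.arch (Fp L) L (IsCMField.complexConj L) (n + n) (hermD L e dV hdV dW hdW) → ℂ), FiniteDimensional ℂ V ∧ bA s ∈ V ∧
      ∀ a₀ : UnitaryGroup.arch (Fp L) L (IsCMField.complexConj L) (n + n) (hermD L e dV hdV dW hdW), (UnitaryGroup.archToAdelic (Fp L) L (IsCMField.complexConj L) (n + n) (hermD L e dV hdV dW hdW) a₀ : HA L e dV hdV dW hdW) ∈ 𝒦'.K → ∀ G ∈ V, (fun x => G (x * a₀)) ∈ V := fun s => by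
    rw [hbA]; exact heightTwistArch_kfinite L e dV hdV hdV0 dW hdW hdW0 𝒦' hbfin s
  have hbAc : ∀ s : ℂ, Continuous (bA s) := fun s => by
    rw [hbA]; exact continuous_heightTwistArch L e dV hdV hdV0 dW hdW hdW0 𝒦' s₀ s hbc
  have hflat : ∀ (s s' : ℂ) (a₀ : UnitaryGroup.arch (Fp L) L (IsCMField.complexConj L) (n + n) (hermD L e dV hdV dW hdW)), (UnitaryGroup.archToAdelic (Fp L) L (IsCMField.complexConj L) (n + n) (hermD L e dV hdV dW hdW) a₀ : HA L e dV hdV dW hdW) ∈ 𝒦'.K → bA s a₀ = bA s' a₀ := fun s s' a₀ ha₀ => by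
    rw [hbA]
    show ((modDelta L e dV hdV dW hdW (𝒦'.pPart (UnitaryGroup.archToAdelic (Fp L) L (IsCMField.complexConj L) (n + n) (hermD L e dV hdV dW hdW) a₀)) : ℝ) : ℂ) ^ (2 * (s - s₀)) * b a₀ =
      ((modDelta L e dV hdV dW hdW (𝒦'.pPart (UnitaryGroup.archToAdelic (Fp L) L (IsCMField.complexConj L) (n + n) (hermD L e dV hdV dW hdW) a₀)) : ℝ) : ℂ) ^ (2 * (s' - s₀)) * b a₀
    rw [IwasawaDatum.modDelta_pPart_of_mem_K hK' ha₀, Complex.ofReal_one, Complex.one_cpow, Complex.one_cpow]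
  have hb0 : bA s₀ = b := by
    rw [hbA]; funext u
    show ((modDelta L e dV hdV dW hdW (𝒦'.pPart (UnitaryGroup.archToAdelic (Fp L) L (IsCMField.complexConj L) (n + n) (hermD L e dV hdV dW hdW) u)) : ℝ) : ℂ) ^ (2 * (s₀ - s₀)) * b u = b u
    rw [sub_self, mul_zero, Complex.cpow_zero, one_mul]
  refine ⟨T, bA, rT, νinf, _, Finset.union_subset hTKT hTK𝒦T, hSieg, hkfin, hbAc, hflat, hb0, fun s yi => by rw [hbA], hνinf, hσ, hpure, fun s y => by rw [hrT],
    fun s h' => rfl, ?_⟩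
  intro c D hDT P hP1 hI Fn hloc s hs
  exact smul_whittakerDelta_eq_arch_mul_rest_of_letters L e dV hdV dW hdW T hdV0 hdW0 hn νN νv hνKT νinf hmap hχu hχT (fun s => hstd.1.1 s) hcont hfac
    bA rT hpure S hhT hwT hST c Fn hloc D hDT P hP1 hI s hs

end Summit.HodgeConjecture.HodgeConjecture.Cruxes.HLiu418.K2LiuLocalKernelArchTailPackage

end
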